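import Mathlib

/-!
# Stub `stub_tailParamDeriv` of line `Sketch` (skeleton v6) for crux `TameOrBrodyR4` (stmt-SmoothPoincare4-7826, route SullivanDual)

The `b`-derivative of a jointly smooth family `g b c` of bounded holomorphic functions of `c` on the
exterior domain `{R < |c|}` with `g b c → b` at infinity tends to the identity as `|c| → ∞`,
uniformly for `|b| ≤ R`.

Proof. Put `G b c := g b c - b`. The partial derivative `∂_b G` is bounded by some `L ≥ 0` on the
compact set `{|b| ≤ R + 1} × {|c| = R + 1}` (continuity of the derivative of a `C^∞` map on an open
set), so by the mean value inequality `G (·, c)` is `L`-Lipschitz on the closed ball of radius `R + 1`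
whenever `|c| = R + 1` (`TailParamDeriv.exists_lipschitz`). For `|b| ≤ R`, `|e| ≤ 1`, `n ≥ 1` the
difference quotient `D c := n • (G (b + e / n) c - G b c)` is holomorphic and bounded on `{R < |c|}`,
tends to `0` at infinity and is bounded by `L` on `|c| = R + 1`, so the Schwarz lemma at infinity
(hypothesis `hS`, the neighbouring stub `stub_exteriorSchwarz`) gives `|D c| ≤ L (R + 1) / |c|` for
`|c| ≥ R + 1` (`TailParamDeriv.diffQuot_le`); letting `n → ∞` (`HasFDerivAt.lim_real`) bounds
`‖∂_b G (b, c)‖ = ‖fderiv ℝ (g · c) b - id‖` by `L (R + 1) / |c|` (`TailParamDeriv.fderiv_sub_id_le`),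
which is `≤ ε` once `|c| ≥ max (R + 1) (L (R + 1) / ε)`.

Sources: mean value inequality + Schwarz lemma at infinity (hypothesis `hS`); classical
(Ahlfors, Complex Analysis (1979), Ch. 4). Lean: Mathlib only
(`ContDiffOn.continuousOn_fderiv_of_isOpen`, `IsCompact.exists_bound_of_continuousOn`,
`Convex.norm_image_sub_le_of_norm_hasFDerivWithin_le`, `HasFDerivAt.lim_real`,
`ContinuousLinearMap.opNorm_le_of_unit_norm`).
-/

open scoped Topology ContDiff
open Filter Set Function Metric Complex

-- the registered namespace `Summit.SmoothPoincare4.SmoothPoincare4.…` repeats a component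
set_option linter.dupNamespace false

noncomputable section

namespace Summit.SmoothPoincare4.SmoothPoincare4.Cruxes.TameOrBrodyR4.Sketch

namespace TailParamDeriv

/-- The parameter domain `{p | R < ‖p.2‖} ⊆ ℂ × ℂ` is open. -/
theorem isOpen_dom (R : ℝ) : IsOpen {p : ℂ × ℂ | R < ‖p.2‖} :=
  isOpen_lt continuous_const (continuous_norm.comp continuous_snd)

/-- The partial derivative in `b` of `G (b, c) := g b c - b` at a point of the open domain is the
total derivative of `G` composed with the inclusion `inl`. -/
theorem hasFDerivAt_G (R : ℝ) (g : ℂ → ℂ → ℂ)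
    (hg : ContDiffOn ℝ ∞ (fun p : ℂ × ℂ => g p.1 p.2) {p | R < ‖p.2‖}) (b c : ℂ) (hc : R < ‖c‖) :
    HasFDerivAt (fun b' => g b' c - b')
      ((fderiv ℝ (fun p : ℂ × ℂ => g p.1 p.2 - p.1) (b, c)).comp
        (ContinuousLinearMap.inl ℝ ℂ ℂ)) b := by
  have hp : (b, c) ∈ {p : ℂ × ℂ | R < ‖p.2‖} := hc
  have hG : ContDiffOn ℝ ∞ (fun p : ℂ × ℂ => g p.1 p.2 - p.1) {p | R < ‖p.2‖} :=
    hg.sub contDiffOn_fst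
  have hd : DifferentiableAt ℝ (fun p : ℂ × ℂ => g p.1 p.2 - p.1) (b, c) :=
    (hG.contDiffAt ((isOpen_dom R).mem_nhds hp)).differentiableAt (by simp)
  exact hd.hasFDerivAt.comp b (hasFDerivAt_prodMk_left (𝕜 := ℝ) b c)

/-- **Steps 1–2.** A uniform Lipschitz bound in the parameter: there is `L ≥ 0` such that
`b ↦ g b c - b` is `L`-Lipschitz on the closed ball `{|b| ≤ R + 1}` for every `|c| = R + 1`
(the derivative of the `C^∞` map `(b, c) ↦ g b c - b` is continuous on the open domain, hence
bounded on the compact set `{|b| ≤ R + 1} × {|c| = R + 1}`; then the mean value inequality). -/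
theorem exists_lipschitz (R : ℝ) (g : ℂ → ℂ → ℂ)
    (hg : ContDiffOn ℝ ∞ (fun p : ℂ × ℂ => g p.1 p.2) {p | R < ‖p.2‖}) :
    ∃ L : ℝ, 0 ≤ L ∧ ∀ c : ℂ, ‖c‖ = R + 1 → ∀ b₁ b₂ : ℂ, ‖b₁‖ ≤ R + 1 → ‖b₂‖ ≤ R + 1 →
      ‖(g b₁ c - b₁) - (g b₂ c - b₂)‖ ≤ L * ‖b₁ - b₂‖ := by
  have hΩ := isOpen_dom R
  have hG : ContDiffOn ℝ ∞ (fun p : ℂ × ℂ => g p.1 p.2 - p.1) {p | R < ‖p.2‖} :=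
    hg.sub contDiffOn_fst
  have hcont : ContinuousOn (fderiv ℝ (fun p : ℂ × ℂ => g p.1 p.2 - p.1)) {p | R < ‖p.2‖} :=
    hG.continuousOn_fderiv_of_isOpen hΩ (by simp)
  have hK : IsCompact (closedBall (0 : ℂ) (R + 1) ×ˢ sphere (0 : ℂ) (R + 1)) :=
    (isCompact_closedBall _ _).prod (isCompact_sphere _ _)
  have hKΩ : closedBall (0 : ℂ) (R + 1) ×ˢ sphere (0 : ℂ) (R + 1) ⊆ {p : ℂ × ℂ | R < ‖p.2‖} := by
    rintro ⟨b, c⟩ ⟨-, hc⟩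
    rw [mem_sphere_zero_iff_norm] at hc
    show R < ‖c‖
    rw [hc]
    linarith
  obtain ⟨L₀, hL₀⟩ := hK.exists_bound_of_continuousOn (hcont.mono hKΩ)
  refine ⟨max L₀ 0, le_max_right _ _, fun c hc b₁ b₂ hb₁ hb₂ => ?_⟩
  have hc' : R < ‖c‖ := by
    rw [hc]
    linarith
  exact (convex_closedBall (0 : ℂ) (R + 1)).norm_image_sub_le_of_norm_hasFDerivWithin_le
    (f := fun b' => g b' c - b')
    (f' := fun b' => (fderiv ℝ (fun p : ℂ × ℂ => g p.1 p.2 - p.1) (b', c)).comp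
      (ContinuousLinearMap.inl ℝ ℂ ℂ))
    (fun b' _ => (hasFDerivAt_G R g hg b' c hc').hasFDerivWithinAt)
    (fun b' hb' => calc
      ‖(fderiv ℝ (fun p : ℂ × ℂ => g p.1 p.2 - p.1) (b', c)).comp (ContinuousLinearMap.inl ℝ ℂ ℂ)‖
          ≤ ‖fderiv ℝ (fun p : ℂ × ℂ => g p.1 p.2 - p.1) (b', c)‖ *
            ‖ContinuousLinearMap.inl ℝ ℂ ℂ‖ := ContinuousLinearMap.opNorm_comp_le _ _
      _ ≤ max L₀ 0 * 1 :=
          mul_le_mul ((hL₀ _ ⟨hb', mem_sphere_zero_iff_norm.2 hc⟩).trans (le_max_left _ _))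
            (ContinuousLinearMap.norm_inl_le_one ℝ ℂ ℂ) (norm_nonneg _) (le_max_right _ _)
      _ = max L₀ 0 := mul_one _)
    (mem_closedBall_zero_iff.2 hb₂) (mem_closedBall_zero_iff.2 hb₁)

/-- **Step 3.** The Schwarz lemma at infinity (hypothesis `hS`) applied to the difference quotient
`c ↦ n • (G (b + e / n) c - G b c)` of `G b c := g b c - b`: it is holomorphic and bounded on
`{R < |c|}`, tends to `0` at infinity, and is bounded by `L` on `|c| = R + 1` (Lipschitz bound
`hL`), hence by `L (R + 1) / |c|` for `|c| ≥ R + 1`. -/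
theorem diffQuot_le
    (hS : ∀ (f : ℂ → ℂ) (R₁ R₂ L : ℝ), 0 < R₁ → R₁ < R₂ → DifferentiableOn ℂ f {c | R₁ < ‖c‖} →
      (∃ M : ℝ, ∀ c, R₁ < ‖c‖ → ‖f c‖ ≤ M) → Tendsto f (cocompact ℂ) (𝓝 0) →
      (∀ c : ℂ, ‖c‖ = R₂ → ‖f c‖ ≤ L) → ∀ c : ℂ, R₂ ≤ ‖c‖ → ‖f c‖ ≤ L * R₂ / ‖c‖)
    (R M : ℝ) (hR : 0 < R) (g : ℂ → ℂ → ℂ)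
    (hgh : ∀ b, DifferentiableOn ℂ (g b) {c | R < ‖c‖})
    (hgb : ∀ b c : ℂ, R < ‖c‖ → ‖g b c - b‖ ≤ M)
    (hgl : ∀ b, Tendsto (g b) (cocompact ℂ) (𝓝 b))
    (L : ℝ) (hL0 : 0 ≤ L)
    (hL : ∀ c : ℂ, ‖c‖ = R + 1 → ∀ b₁ b₂ : ℂ, ‖b₁‖ ≤ R + 1 → ‖b₂‖ ≤ R + 1 →
      ‖(g b₁ c - b₁) - (g b₂ c - b₂)‖ ≤ L * ‖b₁ - b₂‖)
    (b e : ℂ) (hb : ‖b‖ ≤ R) (he : ‖e‖ ≤ 1) (n : ℕ) (hn : 1 ≤ n) (c₀ : ℂ) (hc₀ : R + 1 ≤ ‖c₀‖) :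
    ‖(n : ℝ) • ((g (b + (n : ℝ)⁻¹ • e) c₀ - (b + (n : ℝ)⁻¹ • e)) - (g b c₀ - b))‖ ≤
      L * (R + 1) / ‖c₀‖ := by
  set b₁ : ℂ := b + (n : ℝ)⁻¹ • e with hb₁
  have hn1 : (1 : ℝ) ≤ n := by exact_mod_cast hn
  have hn0 : (0 : ℝ) < n := by linarith
  have hte : (n : ℝ)⁻¹ * ‖e‖ ≤ 1 :=
    calc (n : ℝ)⁻¹ * ‖e‖ ≤ 1 * 1 :=
          mul_le_mul (inv_le_one_of_one_le₀ hn1) he (norm_nonneg _) zero_le_one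
      _ = 1 := mul_one _
  have hnb₁ : ‖b₁‖ ≤ R + 1 :=
    calc ‖b₁‖ ≤ ‖b‖ + ‖(n : ℝ)⁻¹ • e‖ := norm_add_le _ _
      _ = ‖b‖ + (n : ℝ)⁻¹ * ‖e‖ := by rw [norm_smul, norm_inv, Real.norm_natCast]
      _ ≤ R + 1 := add_le_add hb hte
  set D : ℂ → ℂ := fun c => (n : ℝ) • ((g b₁ c - b₁) - (g b c - b)) with hD
  have hnD : ∀ c, ‖D c‖ = n * ‖(g b₁ c - b₁) - (g b c - b)‖ := fun c => by
    rw [hD, norm_smul, Real.norm_natCast]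
  have hDd : DifferentiableOn ℂ D {c | R < ‖c‖} :=
    (((hgh b₁).sub_const b₁).sub ((hgh b).sub_const b)).fun_const_smul (n : ℝ)
  have hDb : ∃ M' : ℝ, ∀ c, R < ‖c‖ → ‖D c‖ ≤ M' := by
    refine ⟨n * (M + M), fun c hc => ?_⟩
    rw [hnD]
    gcongr
    exact (norm_sub_le _ _).trans (add_le_add (hgb b₁ c hc) (hgb b c hc))
  have hD0 : Tendsto D (cocompact ℂ) (𝓝 0) := by
    have h1 : Tendsto (fun c => g b₁ c - b₁) (cocompact ℂ) (𝓝 0) :=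
      tendsto_sub_nhds_zero_iff.2 (hgl b₁)
    have h2 : Tendsto (fun c => g b c - b) (cocompact ℂ) (𝓝 0) :=
      tendsto_sub_nhds_zero_iff.2 (hgl b)
    simpa [hD] using (h1.sub h2).const_smul (n : ℝ)
  have hDL : ∀ c : ℂ, ‖c‖ = R + 1 → ‖D c‖ ≤ L := fun c hc =>
    calc ‖D c‖ = n * ‖(g b₁ c - b₁) - (g b c - b)‖ := hnD c
      _ ≤ n * (L * ‖b₁ - b‖) := by
          gcongr
          exact hL c hc b₁ b hnb₁ (by linarith)
      _ = L * ‖e‖ := by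
          rw [hb₁, add_sub_cancel_left, norm_smul, norm_inv, Real.norm_natCast]
          field_simp
      _ ≤ L := mul_le_of_le_one_right hL0 he
  exact hS D R (R + 1) L hR (by linarith) hDd hDb hD0 hDL c₀ hc₀

/-- **Step 4.** Passing to the limit `n → ∞` in `diffQuot_le` (`HasFDerivAt.lim_real` along
`n : ℕ`): for `|b| ≤ R` and `|c| ≥ R + 1`, `‖fderiv ℝ (g · c) b - id‖ ≤ L (R + 1) / |c|`. -/
theorem fderiv_sub_id_le
    (hS : ∀ (f : ℂ → ℂ) (R₁ R₂ L : ℝ), 0 < R₁ → R₁ < R₂ → DifferentiableOn ℂ f {c | R₁ < ‖c‖} →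
      (∃ M : ℝ, ∀ c, R₁ < ‖c‖ → ‖f c‖ ≤ M) → Tendsto f (cocompact ℂ) (𝓝 0) →
      (∀ c : ℂ, ‖c‖ = R₂ → ‖f c‖ ≤ L) → ∀ c : ℂ, R₂ ≤ ‖c‖ → ‖f c‖ ≤ L * R₂ / ‖c‖)
    (R M : ℝ) (hR : 0 < R) (g : ℂ → ℂ → ℂ)
    (hg : ContDiffOn ℝ ∞ (fun p : ℂ × ℂ => g p.1 p.2) {p | R < ‖p.2‖})
    (hgh : ∀ b, DifferentiableOn ℂ (g b) {c | R < ‖c‖})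
    (hgb : ∀ b c : ℂ, R < ‖c‖ → ‖g b c - b‖ ≤ M)
    (hgl : ∀ b, Tendsto (g b) (cocompact ℂ) (𝓝 b))
    (L : ℝ) (hL0 : 0 ≤ L)
    (hL : ∀ c : ℂ, ‖c‖ = R + 1 → ∀ b₁ b₂ : ℂ, ‖b₁‖ ≤ R + 1 → ‖b₂‖ ≤ R + 1 →
      ‖(g b₁ c - b₁) - (g b₂ c - b₂)‖ ≤ L * ‖b₁ - b₂‖)
    (b c : ℂ) (hb : ‖b‖ ≤ R) (hc : R + 1 ≤ ‖c‖) :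
    ‖fderiv ℝ (fun b' => g b' c) b - ContinuousLinearMap.id ℝ ℂ‖ ≤ L * (R + 1) / ‖c‖ := by
  have hc' : R < ‖c‖ := by linarith
  have hdiff : DifferentiableAt ℝ (fun b' => g b' c) b := by
    have h := (hasFDerivAt_G R g hg b c hc').differentiableAt.add differentiableAt_id
    simpa using h
  have hF : HasFDerivAt (fun b' => g b' c - b')
      (fderiv ℝ (fun b' => g b' c) b - ContinuousLinearMap.id ℝ ℂ) b :=
    hdiff.hasFDerivAt.sub (hasFDerivAt_id b)
  refine ContinuousLinearMap.opNorm_le_of_unit_norm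
    (div_nonneg (mul_nonneg hL0 (by linarith)) (norm_nonneg _)) fun e he => ?_
  have hlim := ((hF.lim_real e).comp tendsto_natCast_atTop_atTop).norm
  refine le_of_tendsto hlim (Filter.eventually_atTop.2 ⟨1, fun n hn => ?_⟩)
  exact diffQuot_le hS R M hR g hgh hgb hgl L hL0 hL b e hb he.le n hn c hc

end TailParamDeriv

/-- **Stub C2f (the `b`-derivative of the graph functions tends to the identity, uniformly for
`|b| ≤ R`).** Let `g b c` be jointly `C^∞` in `(b, c)` on `{R < |c|}`, holomorphic in `c`, with
`|g b c - b| ≤ M` and `g b c → b` at infinity, and let `hS` be the Schwarz lemma at infinity. Then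
for every `ε > 0` there is `R₂` with `‖fderiv ℝ (g · c) b - id‖ ≤ ε` whenever `|b| ≤ R`, `|c| ≥ R₂`.
Proof: `TailParamDeriv.exists_lipschitz` (bound `L` on `∂_b (g b c - b)` over
`{|b| ≤ R + 1} × {|c| = R + 1}` + mean value inequality), `TailParamDeriv.diffQuot_le` (Schwarz at
infinity for the difference quotients in `b`), `TailParamDeriv.fderiv_sub_id_le` (limit of the
difference quotients): `‖fderiv ℝ (g · c) b - id‖ ≤ L (R + 1) / |c| ≤ ε` for
`|c| ≥ max (R + 1) (L (R + 1) / ε)`. -/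
theorem stub_tailParamDeriv
    (hS : ∀ (f : ℂ → ℂ) (R₁ R₂ L : ℝ), 0 < R₁ → R₁ < R₂ → DifferentiableOn ℂ f {c | R₁ < ‖c‖} →
      (∃ M : ℝ, ∀ c, R₁ < ‖c‖ → ‖f c‖ ≤ M) → Tendsto f (cocompact ℂ) (𝓝 0) →
      (∀ c : ℂ, ‖c‖ = R₂ → ‖f c‖ ≤ L) → ∀ c : ℂ, R₂ ≤ ‖c‖ → ‖f c‖ ≤ L * R₂ / ‖c‖)
    (R M : ℝ) (hR : 0 < R) (g : ℂ → ℂ → ℂ)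
    (hg : ContDiffOn ℝ ∞ (fun p : ℂ × ℂ => g p.1 p.2) {p | R < ‖p.2‖})
    (hgh : ∀ b, DifferentiableOn ℂ (g b) {c | R < ‖c‖})
    (hgb : ∀ b c : ℂ, R < ‖c‖ → ‖g b c - b‖ ≤ M)
    (hgl : ∀ b, Tendsto (g b) (cocompact ℂ) (𝓝 b)) :
    ∀ ε > 0, ∃ R₂ : ℝ, ∀ b c : ℂ, ‖b‖ ≤ R → R₂ ≤ ‖c‖ →
      ‖fderiv ℝ (fun b' => g b' c) b - ContinuousLinearMap.id ℝ ℂ‖ ≤ ε := by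
  obtain ⟨L, hL0, hL⟩ := TailParamDeriv.exists_lipschitz R g hg
  intro ε hε
  refine ⟨max (R + 1) (L * (R + 1) / ε), fun b c hb hc => ?_⟩
  have hc1 : R + 1 ≤ ‖c‖ := le_trans (le_max_left _ _) hc
  have hc2 : L * (R + 1) / ε ≤ ‖c‖ := le_trans (le_max_right _ _) hc
  have hcpos : 0 < ‖c‖ := by linarith
  calc ‖fderiv ℝ (fun b' => g b' c) b - ContinuousLinearMap.id ℝ ℂ‖ ≤ L * (R + 1) / ‖c‖ :=
      TailParamDeriv.fderiv_sub_id_le hS R M hR g hg hgh hgb hgl L hL0 hL b c hb hc1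
    _ ≤ ε := by
      rw [div_le_iff₀ hcpos]
      calc L * (R + 1) = (L * (R + 1) / ε) * ε := by field_simp
        _ ≤ ‖c‖ * ε := by gcongr
        _ = ε * ‖c‖ := mul_comm _ _

end Summit.SmoothPoincare4.SmoothPoincare4.Cruxes.TameOrBrodyR4.Sketch
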